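import Literature.AnabelianGeometry.EtaleTheta.Discharge.Sec2Prop214iiiBiUpperCore
import Literature.AnabelianGeometry.EtaleTheta.Discharge.Sec2Remark2141Engine
import Literature.AnabelianGeometry.EtaleTheta.KummerDataOfCoreSection
import HarnessLib

/-!
# [EtTh] Remark 2.14.1 — the GENERIC CORE over §1: the second difference of the `Gal(Y̲̲/X̲̲)`-translates of a
# root cocycle is the Kummer class of `q̈^{−2b²}` times a UNIT class; reduction mod `N`; Kummer read-out
# (proof-only companion; part 2b-A of row «RMK2141-NOGO@modelχq»)

S. Mochizuki, *The Étale Theta Function and its Frobenioid-theoretic Manifestations* [EtTh], Publ. RIMS **45**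
(2009), §2 Remark 2.14.1, PRIMS PDF p. 51 (printed p. 277): "although the automorphism `α̈_δ` extends to an
automorphism `α_δ` of `Π^tp_Y[μ_N]`, the automorphism `α_δ` fails to extend to `Π^tp_X[μ_N]` [i.e., since `Ü²` fails
to descend from `Y` to `X`!]"; proof of Prop. 2.14 (ii) p. 50: "the action by an element of `Gal(Y/X)` clearly maps
`Ü²` to a `K^×`-multiple of `Ü²`"; §1 Prop. 1.5 (iii) p. 23: "`η̈^Θ ↦ η̈^Θ − 2a·log(Ü) − (a²/2)·log(q_X) + log(O^×_K̈)`"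
(locators `p.N` = PDF pages; bib key `MochizukiEtTh2009`) [cite: MochizukiEtTh2009, Rmk 2.14.1 p.51].
Cell `abc-iut`, layer L2 [EtTh], seat abc-iut-L2-d1 (gen 9), row «RMK2141-NOGO@modelχq» (abc-iut-L2-lead R1137 /
R1158 (4) / R1180), part 2b, file A (generic); file B (`Sec2Rmk2141AlphaDeltaNoExtension`) closes the row at the
cell's Tate datum of record.  PROOF-ONLY companion — no definition, no instance, no notation, no new named fact —
over abc-iut-L2-t8's §1 instantiation of `X̲̲` (`DoubleUnderline`, `rootCocycles`, `modN`, `thetaEnvData`),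
abc-iut-L2-t2's §2 machinery (`Sec2Prop214iiiBiUpperCore`: the TEMPLATE of this file — orbit decomposition
`exists_eq_conj_mul_cob_of_rootCocycle`, the Prop. 1.5 (iii) displacement `EtaleThetaData.exists_lift_conj_eq`,
`ContH1.infl_conj` / `exists_coboundary_of_mk_eq`), abc-iut-w6-d076's ENGINE (`Sec2Remark2141Engine`, p500356:
«a cocycle extension of `α_δ` to `Π^tp_X[μ_N]` forces `η · (x²·η) = (x·η)² · ∂m` on `Π^tp_Ÿ̲̲`»), and the tree's
continuous Kummer theory (`KummerDataOfCore(Section)`, `KummerContH1`, `Cyclotome`).  Everything consumed BY NAME;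
nothing of another seat restated.

PROVED (generic over EVERY theta setting `D`, étale-theta datum `E`, choice `X̲̲ = C`, level `N` and identification
`μ : CyclotomeMod l N`; the only §1 input is the named fact `Prop15iii E hC`, a THEOREM at the datum of record):
* `DoubleUnderline.exists_unit_sq_translate_cocycle` — for a cocycle `f` of `η̲̈^{Θ,l·ℤ×μ₂}` and a GEOMETRIC
  `x ∈ Π^tp_X̲̲` (`aug x = 1`) with image `b ∈ Z`: there are a unit `w ∈ O^×_K̈` and a cocycle `Ψ` on `Π^tp_Ÿ` with
  `[Ψ] = infl κ̈(q̈^{−2b²}·w)` and `f(g)·f(x⁻²gx²)·(f(x⁻¹gx)²)⁻¹ = Ψ(g)` on `Π^tp_Ÿ̲̲`.  (Write `f = (σ·F)|·∂β`, `F` a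
  cocycle of `η̈^Θ`; by Prop. 1.5 (iii) at `σ`, `xσ`, `x²σ` the classes of the three conjugates are the inflations of
  `x′·log(Ü)^{−2a_k}·κ(q̈)^{−a_k²}·κ(u_k)`, `a_k = a + kb`; in the second difference the `x′`- and `log(Ü)`-terms
  cancel, `κ(q̈)` survives with exponent `−(a² + (a+2b)² − 2(a+b)²) = −2b²` — «`Ü²` fails to descend», p. 50 — and
  the UNITS collect into `w = u₀u₂u₁⁻²`; pointwise the coboundary `∂β` is `x`-invariant since `Δ^tp_X` centralises
  `Δ_Θ`.)
* `DoubleUnderline.exists_pow_of_red_sq_translate` — if moreover the mod-`N` theta cocycle `η = red ∘ f` of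
  `X̲̲.thetaEnvData μ` satisfies the ENGINE's conclusion `η·(x²·η) = (x·η)²·∂m` on `Π^tp_Ÿ̲̲` (`x` geometric, so the
  cyclotomic twists are `1`), then `Ψ(g)·∂e(g)` is an `N`-th power in `Δ_Θ` for every `g ∈ Π^tp_Ÿ̲̲`, for ONE
  `e ∈ Δ_Θ` (`red` is onto, `G_K`-equivariant, with kernel `N·(l·Δ_Θ)`).
* `DoubleUnderline.exists_mem_K_pow_eq_of_pow` — over a Kummer CORE (`κ̈` = the tree's continuous Kummer map with
  coefficients `Λ(ℚ̄_p^×) ≅ Δ_Θ`): if a cocycle in the class `infl κ̈(v)` (`v ∈ K̈^×`) is pointwise on `Π^tp_Ÿ̲̲` an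
  `N`-th power up to a `Δ_Θ`-coboundary, then `v = u^N` for a unit `u ∈ K̄` FIXED BY `G_K = aug(Π^tp_Ÿ̲̲)`, i.e.
  `u ∈ K` — by reading the Kummer cocycle of a compatible root system of `v` and the coboundary through
  `Λ(ℚ̄_p^×) ≅ Δ_Θ` and taking `N`-th COMPONENTS (`σ(v^{1/N})/v^{1/N} · σ(ε_N)/ε_N = ξ_N^N = 1`); no Hilbert 90 and
  no generator of `Ẑ(1)` are needed.
File B evaluates these at the datum of record (`K = K̈ = ℚ_p`, `q̈ = p`): `‖u‖^N = p^{2l²}` forces `N ∣ 2l²`.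
HONEST FRAMING: [EtTh] is refereed; these are OUR kernel checks of elementary cocycle / Kummer algebra over the
cell's typed §1 objects, conditional where stated on the named §1 fact `Prop15iii` BY NAME; nothing of [EtTh] is
endorsed or disputed; no side is taken on [IUTchIII] Cor. 3.12; typed ≠ proved elsewhere.
-/

noncomputable section

namespace Literature.AnabelianGeometry.EtaleTheta

open Literature.AnabelianGeometry.SemiGraphs
open scoped IsMulCommutative

namespace ThetaSetting

variable {p : ℕ} [Fact p.Prime] {D : ThetaSetting p}

namespace EtaleThetaData.DoubleUnderline

variable {E : D.EtaleThetaData} {l : ℕ} (C : E.DoubleUnderline l)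

/-- **Second difference of the translates of a root cocycle (class and pointwise).** For a cocycle `f` of
`η̲̈^{Θ,l·ℤ×μ₂}` and a GEOMETRIC `x ∈ Π^tp_X̲̲` (`aug x = 1`) with image `b` in `Z`: writing `f = (σ·F)|·∂β` with
`F` a cocycle of `η̈^Θ` (Def. 2.7: the collection is the `Π^tp_X̲̲`-orbit), the cocycle
`Ψ := (σ·F)·(x²σ·F)·((xσ·F))⁻²` on `Π^tp_Ÿ` satisfies `f(g)·f(x⁻²gx²)·(f(x⁻¹gx)·f(x⁻¹gx))⁻¹ = Ψ(g)` on
`Π^tp_Ÿ̲̲` (the coboundary `∂β` is `x`-invariant since `Δ^tp_X` centralises `Δ_Θ`), and by Prop. 1.5 (iii)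
(displacements `x′·log(Ü)^{-2a}·κ(q̈)^{-a²}·κ(u_a)` at `a`, `a+b`, `a+2b`) its class is the inflation of the Kummer
class `κ̈(q̈^{-2b²}·w)` for the UNIT `w = u₀u₂u₁⁻² ∈ O^×_K̈` (the `log(Ü)`- and `x′`-terms cancel).
[cite: MochizukiEtTh2009, Rmk 2.14.1 p.51] -/
theorem exists_unit_sq_translate_cocycle (hC : D.Compat) (h15 : Prop15iii E hC)
    {f : contCocycles D.toTheta D.DeltaTheta C.GtpYdduu} (hf : f ∈ C.rootCocycles hC) (x : C.Huu)
    (hx : D.aug.toMonoidHom (x : D.PiTemp) = 1) :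
    ∃ w ∈ D.unitsOKdd, ∃ Ψ : contCocycles D.toTheta D.DeltaTheta D.GtpYdd,
      (QuotientGroup.mk Ψ : D.H1 D.GtpYdd) =
        D.inflTheta D.GtpYdd (E.kumYdd (E.toKddHat
          (D.qddUnit ^ (-(2 * (Multiplicative.toAdd (D.toZ (x : D.PiTemp)) *
            Multiplicative.toAdd (D.toZ (x : D.PiTemp))))) * w))) ∧
      ∀ g : C.GtpYdduu,
        f.1 g * f.1 ⟨((x * x : C.Huu) : D.PiTemp)⁻¹ * g * (x * x : C.Huu), C.inv_mul_mul_mem_GtpYdduu hC (x * x) g⟩ *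
          (f.1 ⟨(x : D.PiTemp)⁻¹ * g * x, C.inv_mul_mul_mem_GtpYdduu hC x g⟩ *
            f.1 ⟨(x : D.PiTemp)⁻¹ * g * x, C.inv_mul_mul_mem_GtpYdduu hC x g⟩)⁻¹ =
        Ψ.1 ⟨g, (Subgroup.mem_inf.1 g.2).1⟩ := by
  haveI := hC.GtpYdd_normal
  haveI := hC.GtpYddTheta_normal
  -- a cocycle `F = f₀` of `η̈^Θ` on `Π^tp_Ÿ`, and the orbit decomposition `f = (σ·F)| · ∂β`
  obtain ⟨f₀, hf₀⟩ := QuotientGroup.mk_surjective E.etaDd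
  obtain ⟨σ, hσ, β, hfb⟩ := C.exists_eq_conj_mul_cob_of_rootCocycle hC f₀.2 hf₀ hf
  set G₀ := ContH1.conjCocycle D.toTheta D.DeltaTheta σ f₀ with hG₀
  set G₁ := ContH1.conjCocycle D.toTheta D.DeltaTheta ((x : D.PiTemp) * σ) f₀ with hG₁
  set G₂ := ContH1.conjCocycle D.toTheta D.DeltaTheta ((x : D.PiTemp) * x * σ) f₀ with hG₂
  -- Prop. 1.5 (iii): the lift `x'` and the three displacements
  obtain ⟨x', hx', hΦ⟩ := E.exists_lift_conj_eq hC h15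
  obtain ⟨u₀, hu₀, e₀⟩ := hΦ σ
  obtain ⟨u₁, hu₁, e₁⟩ := hΦ ((x : D.PiTemp) * σ)
  obtain ⟨u₂, hu₂, e₂⟩ := hΦ ((x : D.PiTemp) * x * σ)
  refine ⟨u₀ * u₂ * (u₁ * u₁)⁻¹, ?_, G₀ * G₂ * (G₁ * G₁)⁻¹, ?_, ?_⟩
  · exact D.unitsOKdd.mul_mem (D.unitsOKdd.mul_mem hu₀ hu₂)
      (D.unitsOKdd.inv_mem (D.unitsOKdd.mul_mem hu₁ hu₁))
  · -- the class computation
    set a : ℤ := Multiplicative.toAdd (D.toZ σ) with ha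
    set b : ℤ := Multiplicative.toAdd (D.toZ (x : D.PiTemp)) with hb
    have ha₁ : Multiplicative.toAdd (D.toZ ((x : D.PiTemp) * σ)) = b + a := by
      rw [map_mul D.toZ, toAdd_mul]
    have ha₂ : Multiplicative.toAdd (D.toZ ((x : D.PiTemp) * x * σ)) = b + b + a := by
      rw [map_mul D.toZ, map_mul D.toZ, toAdd_mul, toAdd_mul]
    rw [ha₁] at e₁
    rw [ha₂] at e₂
    have hinfl : ∀ τ : D.PiTemp, ContH1.conj D.toTheta D.DeltaTheta τ E.etaDd =
        D.inflTheta D.GtpYdd (ContH1.conj (MonoidHom.id D.GtpTheta) D.DeltaTheta (D.toTheta τ) x') := by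
      intro τ
      rw [← hx']
      exact (ContH1.infl_conj (H₀ := D.GtpYdd) (H' := D.GtpYdd.map D.toTheta)
        (hψ := D.continuous_toTheta) le_rfl τ x').symm
    have hmk : (QuotientGroup.mk (G₀ * G₂ * (G₁ * G₁)⁻¹) : D.H1 D.GtpYdd) =
        ContH1.conj D.toTheta D.DeltaTheta σ E.etaDd *
          ContH1.conj D.toTheta D.DeltaTheta ((x : D.PiTemp) * x * σ) E.etaDd *
          (ContH1.conj D.toTheta D.DeltaTheta ((x : D.PiTemp) * σ) E.etaDd *
            ContH1.conj D.toTheta D.DeltaTheta ((x : D.PiTemp) * σ) E.etaDd)⁻¹ := by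
      rw [← hf₀]; rfl
    rw [hmk, hinfl, hinfl, hinfl, e₀, e₁, e₂, ← map_mul (D.inflTheta D.GtpYdd),
      ← map_mul (D.inflTheta D.GtpYdd), ← map_inv (D.inflTheta D.GtpYdd), ← map_mul (D.inflTheta D.GtpYdd)]
    congr 1
    rw [map_mul E.toKddHat, map_mul E.kumYdd, map_zpow, map_zpow, map_mul E.toKddHat, map_mul E.kumYdd,
      map_mul E.toKddHat, map_mul E.kumYdd, map_inv E.toKddHat, map_inv E.kumYdd, map_mul E.toKddHat,
      map_mul E.kumYdd]
    apply (Additive.ofMul : D.H1Theta (D.GtpYdd.map D.toTheta) ≃ _).injective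
    simp only [ofMul_mul, ofMul_inv, ofMul_zpow]
    module
  · -- the pointwise identity on `Π^tp_Ÿ̲̲`
    intro g
    set k₁ : C.GtpYdduu := ⟨(x : D.PiTemp)⁻¹ * g * x, C.inv_mul_mul_mem_GtpYdduu hC x g⟩ with hk₁
    set k₂ : C.GtpYdduu := ⟨((x * x : C.Huu) : D.PiTemp)⁻¹ * g * (x * x : C.Huu),
      C.inv_mul_mul_mem_GtpYdduu hC (x * x) g⟩ with hk₂
    have hxinv : D.aug.toMonoidHom ((x : D.PiTemp)⁻¹) = 1 := by rw [map_inv, hx, inv_one]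
    have hk₁v : (k₁ : D.PiTemp) = (x : D.PiTemp)⁻¹ * g * x := rfl
    have hk₂v : (k₂ : D.PiTemp) = (x : D.PiTemp)⁻¹ * ((x : D.PiTemp)⁻¹ * g * x) * x := by
      rw [hk₂]
      change ((x : D.PiTemp) * x)⁻¹ * g * ((x : D.PiTemp) * x) = _
      group
    -- conjugation by `x`, `x⁻¹` is trivial on `Δ_Θ` (`Δ^tp_X` centralises `Δ_Θ`)
    have hcx : ∀ (τ : D.PiTemp) (v : D.DeltaTheta),
        MulAut.conjNormal (D.toTheta ((x : D.PiTemp) * τ)) v = MulAut.conjNormal (D.toTheta τ) v := by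
      intro τ v
      rw [map_mul, map_mul, MulAut.mul_apply, conjNormal_eq_of_aug_eq_one hx]
    have hcob : ∀ k : D.PiTemp, MulAut.conjNormal (D.toTheta ((x : D.PiTemp)⁻¹ * k * x)) β =
        MulAut.conjNormal (D.toTheta k) β := by
      intro k
      rw [map_mul, map_mul, map_mul, map_mul, MulAut.mul_apply, MulAut.mul_apply,
        conjNormal_eq_of_aug_eq_one hx, conjNormal_eq_of_aug_eq_one hxinv]
    -- `f` at the three points
    have h0 : f.1 g = G₀.1 ⟨g, (Subgroup.mem_inf.1 g.2).1⟩ *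
        (MulAut.conjNormal (D.toTheta (g : D.PiTemp)) β * β⁻¹) := by
      rw [hfb g, hG₀]
      congr 1
      exact (ContH1.conjCocycle_apply_eq σ f₀ _ _ rfl).symm
    have hcob₁ : MulAut.conjNormal (D.toTheta (k₁ : D.PiTemp)) β = MulAut.conjNormal (D.toTheta g) β :=
      hcob (g : D.PiTemp)
    have hcob₂ : MulAut.conjNormal (D.toTheta (k₂ : D.PiTemp)) β = MulAut.conjNormal (D.toTheta g) β := by
      rw [hk₂v, hcob, hcob]
    have h1 : f.1 k₁ = G₁.1 ⟨g, (Subgroup.mem_inf.1 g.2).1⟩ *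
        (MulAut.conjNormal (D.toTheta (g : D.PiTemp)) β * β⁻¹) := by
      rw [hfb k₁, hG₁, ContH1.conjCocycle_apply_eq ((x : D.PiTemp) * σ) f₀ ⟨g, (Subgroup.mem_inf.1 g.2).1⟩
        ⟨σ⁻¹ * (k₁ : D.PiTemp) * σ, hC.GtpYdd_normal.conj_mem' _ (Subgroup.mem_inf.1 k₁.2).1 σ⟩
        (by
          show σ⁻¹ * ((x : D.PiTemp)⁻¹ * g * x) * σ = ((x : D.PiTemp) * σ)⁻¹ * g * ((x : D.PiTemp) * σ)
          group), hcx, hcob₁]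
    have h2 : f.1 k₂ = G₂.1 ⟨g, (Subgroup.mem_inf.1 g.2).1⟩ *
        (MulAut.conjNormal (D.toTheta (g : D.PiTemp)) β * β⁻¹) := by
      rw [hfb k₂, hG₂, ContH1.conjCocycle_apply_eq ((x : D.PiTemp) * x * σ) f₀ ⟨g, (Subgroup.mem_inf.1 g.2).1⟩
        ⟨σ⁻¹ * (k₂ : D.PiTemp) * σ, hC.GtpYdd_normal.conj_mem' _ (Subgroup.mem_inf.1 k₂.2).1 σ⟩
        (by
          show σ⁻¹ * (((x * x : C.Huu) : D.PiTemp)⁻¹ * g * (x * x : C.Huu)) * σ =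
            ((x : D.PiTemp) * x * σ)⁻¹ * g * ((x : D.PiTemp) * x * σ)
          rw [Subgroup.coe_mul]
          group), mul_assoc (x : D.PiTemp), hcx, hcx, hcob₂]
    rw [h0, h1, h2]
    change _ = G₀.1 ⟨g, _⟩ * G₂.1 ⟨g, _⟩ * (G₁.1 ⟨g, _⟩ * G₁.1 ⟨g, _⟩)⁻¹
    apply (Additive.ofMul : D.DeltaTheta ≃ _).injective
    simp only [ofMul_mul, ofMul_inv]
    abel

/-- **Reduction mod `N` of the second difference.** If, in addition, the mod-`N` theta cocycle `η = red ∘ f` of the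
mono-theta datum `X̲̲.thetaEnvData μ` satisfies the conclusion of the engine of Remark 2.14.1
(`ThetaEnvData.exists_coboundary_sq_translate_of_extension`: `η · (x²·η) = (x·η)² · ∂m` on `Π^tp_Ÿ̲̲`), then the
cocycle `Ψ` of `exists_unit_sq_translate_cocycle` is, pointwise on `Π^tp_Ÿ̲̲` and up to ONE `Δ_Θ`-coboundary, an
`N`-th power in `l·Δ_Θ` (`red` is `G_K`-equivariant with kernel `N·(l·Δ_Θ)`). [cite: MochizukiEtTh2009, Rmk 2.14.1 p.51] -/
theorem exists_pow_of_red_sq_translate (hC : D.Compat) (hS : D.Sec2Hyps) {N : ℕ+} (μ : D.CyclotomeMod l N)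
    {f : contCocycles D.toTheta D.DeltaTheta C.GtpYdduu} (hf : f ∈ C.rootCocycles hC) (x : C.Huu)
    (hx : D.aug.toMonoidHom (x : D.PiTemp) = 1)
    (Ψ : contCocycles D.toTheta D.DeltaTheta D.GtpYdd)
    (hΨ : ∀ g : C.GtpYdduu,
      f.1 g * f.1 ⟨((x * x : C.Huu) : D.PiTemp)⁻¹ * g * (x * x : C.Huu), C.inv_mul_mul_mem_GtpYdduu hC (x * x) g⟩ *
        (f.1 ⟨(x : D.PiTemp)⁻¹ * g * x, C.inv_mul_mul_mem_GtpYdduu hC x g⟩ *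
          f.1 ⟨(x : D.PiTemp)⁻¹ * g * x, C.inv_mul_mul_mem_GtpYdduu hC x g⟩)⁻¹ =
      Ψ.1 ⟨g, (Subgroup.mem_inf.1 g.2).1⟩)
    (hm : ∃ m : (C.thetaEnvData μ hC hS).mu, ∀ g : (C.thetaEnvData μ hC hS).PiYdd,
      C.modN μ f hf.1 g *
          (C.thetaEnvData μ hC hS).chi ((C.thetaEnvData μ hC hS).aug (x * x))
            (C.modN μ f hf.1 ⟨(x * x)⁻¹ * g * (x * x), (C.thetaEnvData μ hC hS).inv_mul_mul_mem_PiYdd (x * x) g⟩) =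
        (C.thetaEnvData μ hC hS).chi ((C.thetaEnvData μ hC hS).aug x)
            (C.modN μ f hf.1 ⟨x⁻¹ * g * x, (C.thetaEnvData μ hC hS).inv_mul_mul_mem_PiYdd x g⟩) ^ 2 *
          CycEnvelope.coboundary ((C.thetaEnvData μ hC hS).aug.comp (C.thetaEnvData μ hC hS).PiYdd.subtype)
            (C.thetaEnvData μ hC hS).chi m g) :
    ∃ e : D.DeltaTheta, ∀ g : C.GtpYdduu, ∃ z : D.DeltaTheta,
      Ψ.1 ⟨g, (Subgroup.mem_inf.1 g.2).1⟩ * (MulAut.conjNormal (D.toTheta (g : D.PiTemp)) e * e⁻¹) =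
        z ^ (N : ℕ) := by
  obtain ⟨m, hm⟩ := hm
  obtain ⟨y₀, hy₀⟩ := μ.red_surjective m
  have hχ : (C.thetaEnvData μ hC hS).chi ((C.thetaEnvData μ hC hS).aug x) = 1 := by
    change galMuN p N (D.aug.toMonoidHom ((x : C.Huu) : D.PiTemp)) = 1
    rw [hx, map_one]
  have hχ2 : (C.thetaEnvData μ hC hS).chi ((C.thetaEnvData μ hC hS).aug (x * x)) = 1 := by
    rw [map_mul, map_mul, hχ, mul_one]
  refine ⟨⟨(y₀ : D.GtpTheta), D.lDeltaTheta_le l y₀.2⟩, fun g => ?_⟩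
  -- the element of `Π^tp_Ÿ̲̲ ≤ Π^tp_X̲̲` in the envelope's currency
  let g' : (C.thetaEnvData μ hC hS).PiYdd :=
    ⟨⟨(g : D.PiTemp), (Subgroup.mem_inf.1 g.2).2⟩, Subgroup.mem_subgroupOf.2 (Subgroup.mem_inf.1 g.2).1⟩
  have key := hm g'
  rw [hχ, hχ2, MulAut.one_apply, MulAut.one_apply] at key
  -- the three values of `η = red ∘ f`, as reductions of elements of `l·Δ_Θ`
  have hA : C.modN μ f hf.1 g' = μ.red ⟨(f.1 g : D.GtpTheta), hf.1 g⟩ := rfl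
  have hA₁ : C.modN μ f hf.1 ⟨x⁻¹ * g' * x, (C.thetaEnvData μ hC hS).inv_mul_mul_mem_PiYdd x g'⟩ =
      μ.red ⟨(f.1 ⟨(x : D.PiTemp)⁻¹ * g * x, C.inv_mul_mul_mem_GtpYdduu hC x g⟩ : D.GtpTheta), hf.1 _⟩ := rfl
  have hA₂ : C.modN μ f hf.1 ⟨(x * x)⁻¹ * g' * (x * x), (C.thetaEnvData μ hC hS).inv_mul_mul_mem_PiYdd (x * x) g'⟩ =
      μ.red ⟨(f.1 ⟨((x * x : C.Huu) : D.PiTemp)⁻¹ * g * (x * x : C.Huu), C.inv_mul_mul_mem_GtpYdduu hC (x * x) g⟩ :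
        D.GtpTheta), hf.1 _⟩ := rfl
  have hcob : CycEnvelope.coboundary ((C.thetaEnvData μ hC hS).aug.comp (C.thetaEnvData μ hC hS).PiYdd.subtype)
      (C.thetaEnvData μ hC hS).chi m g' = m * (galMuN p N (D.aug.toMonoidHom (g : D.PiTemp)) m)⁻¹ := rfl
  rw [hA, hA₁, hA₂, hcob] at key
  -- the conjugate of `y₀` by `g` and the `red`-identity `red(A·A₂·(A₁·A₁)⁻¹·(g y₀ g⁻¹)·y₀⁻¹) = 1`
  set A : D.lDeltaTheta l := ⟨(f.1 g : D.GtpTheta), hf.1 g⟩ with hAdef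
  set A₁ : D.lDeltaTheta l :=
    ⟨(f.1 ⟨(x : D.PiTemp)⁻¹ * g * x, C.inv_mul_mul_mem_GtpYdduu hC x g⟩ : D.GtpTheta), hf.1 _⟩ with hA₁def
  set A₂ : D.lDeltaTheta l :=
    ⟨(f.1 ⟨((x * x : C.Huu) : D.PiTemp)⁻¹ * g * (x * x : C.Huu), C.inv_mul_mul_mem_GtpYdduu hC (x * x) g⟩ :
      D.GtpTheta), hf.1 _⟩ with hA₂def
  set Y : D.lDeltaTheta l := ⟨D.toTheta (g : D.PiTemp) * y₀ * (D.toTheta (g : D.PiTemp))⁻¹,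
    (D.lDeltaTheta_normal l).conj_mem _ y₀.2 _⟩ with hYdef
  have hY : μ.red Y = galMuN p N (D.aug.toMonoidHom (g : D.PiTemp)) m := by
    rw [hYdef, μ.red_conj, hy₀]
  have h1 : μ.red (A * A₂ * (A₁ * A₁)⁻¹ * (Y * y₀⁻¹)) = 1 := by
    simp only [map_mul, map_inv, hY, hy₀]
    rw [key]
    apply (Additive.ofMul : MuN p N ≃ Additive (MuN p N)).injective
    simp only [ofMul_mul, ofMul_inv, ofMul_pow, ofMul_one]
    abel
  obtain ⟨z, hz⟩ := (μ.red_ker _).1 h1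
  refine ⟨⟨(z : D.GtpTheta), D.lDeltaTheta_le l z.2⟩, Subtype.ext ?_⟩
  have hv := congrArg (fun t : D.lDeltaTheta l => (t : D.GtpTheta)) hz
  simp only [Subgroup.coe_mul, Subgroup.coe_inv, SubmonoidClass.coe_pow] at hv
  rw [SubmonoidClass.coe_pow]
  change ((Ψ.1 ⟨g, _⟩ * (MulAut.conjNormal (D.toTheta (g : D.PiTemp)) _ * _⁻¹) : D.DeltaTheta) : D.GtpTheta) =
    (z : D.GtpTheta) ^ (N : ℕ)
  rw [← hv, ← hΨ g]
  simp only [hAdef, hA₁def, hA₂def, hYdef, Subgroup.coe_mul, Subgroup.coe_inv, MulAut.conjNormal_apply,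
    mul_inv_rev, mul_assoc]

/-- **From `N`-th powers to an `N`-th root in `K`.** Over a Kummer CORE (so that `κ̈` is the tree's continuous
Kummer map with coefficients `Λ(ℚ̄_p^×) ≅ Δ_Θ`): if a cocycle `Ψ` on `Π^tp_Ÿ` in the class `infl κ̈(v)` (`v ∈ K̈^×`)
is pointwise on `Π^tp_Ÿ̲̲`, up to a `Δ_Θ`-coboundary, an `N`-th power, then `v` is an `N`-th power of an element of
`K̄` fixed by `G_K` — i.e. of `K`: reading the Kummer cocycle of a compatible root system `(v^{1/n})_n` and the
coboundary through `Λ(ℚ̄_p^×) ≅ Δ_Θ` and taking `N`-th COMPONENTS, `σ(v^{1/N})/v^{1/N} · σ(ε_N)/ε_N = ξ_N^N = 1` for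
every `σ ∈ G_K = aug(Π^tp_Ÿ̲̲)`. [cite: MochizukiEtTh2009, Rmk 2.14.1 p.51] -/
theorem exists_mem_K_pow_eq_of_pow (Cr : D.KummerCore) (v : (↥D.Kdd)ˣ) {N : ℕ+}
    (Ψ : contCocycles D.toTheta D.DeltaTheta D.GtpYdd)
    (hΨ : (QuotientGroup.mk Ψ : D.H1 D.GtpYdd) =
      D.inflTheta D.GtpYdd (Cr.toKummerData.kumYdd (Cr.toKummerData.toKddHat v)))
    (e : D.DeltaTheta)
    (hpow : ∀ g : C.GtpYdduu, ∃ z : D.DeltaTheta,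
      Ψ.1 ⟨g, (Subgroup.mem_inf.1 g.2).1⟩ * (MulAut.conjNormal (D.toTheta (g : D.PiTemp)) e * e⁻¹) =
        z ^ (N : ℕ)) :
    ∃ u : (PadicAlgCl p)ˣ, (u : PadicAlgCl p) ∈ D.K ∧ (u : PadicAlgCl p) ^ (N : ℕ) = ((v : D.Kdd) : PadicAlgCl p) := by
  letI := D.unitsAction Cr.augTheta
  -- the Kummer cocycle of the standard root system of `v`
  set a : Cr.invYdd := Cr.toInvYdd v with ha
  have hΨ' : (QuotientGroup.mk (ContH1.inflCocycle D.DeltaTheta D.toTheta D.continuous_toTheta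
      (le_rfl : D.GtpYdd.map D.toTheta ≤ D.GtpYdd.map D.toTheta)
      (Cr.coeff.kummerContCocycle (D.GtpYdd.map D.toTheta) (RootSystem.ofRootableBy (a : (PadicAlgCl p)ˣ)) a.2
        fun _ => Cr.isOpen_stabilizer' _)) : D.H1 D.GtpYdd) = QuotientGroup.mk Ψ := by
    rw [hΨ]; rfl
  obtain ⟨d, hd⟩ := ContH1.exists_coboundary_of_mk_eq _ _ hΨ'
  -- `d · e = c(ε)` for some `ε ∈ Λ(ℚ̄_p^×)`
  obtain ⟨ε, hε⟩ := Cr.bijective_coeffHom.2 (d * e)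
  refine ⟨(RootSystem.ofRootableBy (a : (PadicAlgCl p)ˣ)).root N * (ε : ℕ+ → (PadicAlgCl p)ˣ) N, ?_, ?_⟩
  · -- fixed by `G_K = aug(Π^tp_Ÿ̲̲)`
    apply KummerCore.coe_mem_of_forall_fixingSubgroup D.K
    intro σ hσ
    have hσ' : σ ∈ (D.GtpYdd ⊓ C.Huu).map D.aug.toMonoidHom := by rw [C.map_aug_Ydduu]; exact hσ
    obtain ⟨g, hg, rfl⟩ := hσ'
    obtain ⟨z, hz⟩ := hpow ⟨g, hg⟩
    obtain ⟨ξ, hξ⟩ := Cr.bijective_coeffHom.2 z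
    have hdg := hd ⟨g, (Subgroup.mem_inf.1 hg).1⟩
    have hK : (ContH1.inflCocycle D.DeltaTheta D.toTheta D.continuous_toTheta
        (le_rfl : D.GtpYdd.map D.toTheta ≤ D.GtpYdd.map D.toTheta)
        (Cr.coeff.kummerContCocycle (D.GtpYdd.map D.toTheta) (RootSystem.ofRootableBy (a : (PadicAlgCl p)ˣ)) a.2
          fun _ => Cr.isOpen_stabilizer' _)).1 ⟨g, (Subgroup.mem_inf.1 hg).1⟩ =
        Cr.coeffHom ((RootSystem.ofRootableBy (a : (PadicAlgCl p)ˣ)).kummerCocycle a.2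
          ⟨D.toTheta g, ⟨g, (Subgroup.mem_inf.1 hg).1, rfl⟩⟩) := rfl
    -- the pointwise identity read in `Δ_Θ`: `c(ζ_g · σ(ε) · ε⁻¹) = c(ξ^N)`
    have key : Cr.coeffHom ((RootSystem.ofRootableBy (a : (PadicAlgCl p)ˣ)).kummerCocycle a.2
        ⟨D.toTheta g, ⟨g, (Subgroup.mem_inf.1 hg).1, rfl⟩⟩ *
          (Cr.augTheta (D.toTheta g) • ε) * ε⁻¹) = Cr.coeffHom (ξ ^ (N : ℕ)) := by
      rw [map_mul Cr.coeffHom, map_mul Cr.coeffHom, map_inv Cr.coeffHom, map_pow Cr.coeffHom, hξ, ← hz,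
        Cr.coeffHom_smul, hε, hdg, hK, map_mul (MulAut.conjNormal (D.toTheta g)), mul_inv]
      apply (Additive.ofMul : D.DeltaTheta ≃ _).injective
      simp only [ofMul_mul, ofMul_inv]
      abel
    -- `N`-th components: `σ(r)/r · σ(ε_N) · ε_N⁻¹ = ξ_N^N = 1`
    have key' : Cr.augTheta (D.toTheta g) • (RootSystem.ofRootableBy (a : (PadicAlgCl p)ˣ)).root N /
        (RootSystem.ofRootableBy (a : (PadicAlgCl p)ˣ)).root N *
          (Cr.augTheta (D.toTheta g) • (ε : ℕ+ → (PadicAlgCl p)ˣ) N) * ((ε : ℕ+ → (PadicAlgCl p)ˣ) N)⁻¹ =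
        ((ξ : ℕ+ → (PadicAlgCl p)ˣ) N) ^ (N : ℕ) :=
      congrArg (fun ζ : cyclotome (PadicAlgCl p)ˣ => (ζ : ℕ+ → (PadicAlgCl p)ˣ) N) (Cr.bijective_coeffHom.1 key)
    rw [cyclotome.pow_eq_one, Cr.augTheta_toTheta] at key'
    show D.aug g • ((RootSystem.ofRootableBy (a : (PadicAlgCl p)ˣ)).root N * (ε : ℕ+ → (PadicAlgCl p)ˣ) N) =
      (RootSystem.ofRootableBy (a : (PadicAlgCl p)ˣ)).root N * (ε : ℕ+ → (PadicAlgCl p)ˣ) N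
    calc D.aug g • ((RootSystem.ofRootableBy (a : (PadicAlgCl p)ˣ)).root N * (ε : ℕ+ → (PadicAlgCl p)ˣ) N)
        = (D.aug g • (RootSystem.ofRootableBy (a : (PadicAlgCl p)ˣ)).root N /
              (RootSystem.ofRootableBy (a : (PadicAlgCl p)ˣ)).root N *
              (D.aug g • (ε : ℕ+ → (PadicAlgCl p)ˣ) N) * ((ε : ℕ+ → (PadicAlgCl p)ˣ) N)⁻¹) *
            ((RootSystem.ofRootableBy (a : (PadicAlgCl p)ˣ)).root N * (ε : ℕ+ → (PadicAlgCl p)ˣ) N) := by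
          rw [smul_mul']
          apply (Additive.ofMul : (PadicAlgCl p)ˣ ≃ _).injective
          simp only [ofMul_mul, ofMul_inv, ofMul_div]
          abel
      _ = _ := by rw [key', one_mul]
  · rw [Units.val_mul, mul_pow, ← Units.val_pow_eq_pow_val, ← Units.val_pow_eq_pow_val,
      RootSystem.pow_self, cyclotome.pow_eq_one, Units.val_one, mul_one]
    exact Cr.coe_toInvYdd v

end EtaleThetaData.DoubleUnderline

end ThetaSetting

end Literature.AnabelianGeometry.EtaleTheta

end
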